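import Literature.Geometry.Kaehler.ComplexTorusTranscendentalLatticeAllDegreesIsogeny
import Literature.Geometry.Kaehler.ComplexTorusCorrespondenceComposition
import Literature.Geometry.Kaehler.ComplexTorusIntegralHodgeClassesProduct
import HarnessLib

/-!
# The transcendental lattice in every degree on a PRODUCT torus `X₁ × X₂`, along the second projection:
# `p₂^* T(X₂) ⊆ T(X₁ × X₂)`, `p_{2*} T(X₁ × X₂) ⊆ T(X₂)`, `ι₂^* = p_{2*}(pr₁^* vol_{X₁} ∧ ·)`, `ι₂^* T(X₁ × X₂) ⊆ T(X₂)`,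
# and `T(X₂)` is a direct summand of `T(X₁ × X₂)` (`ι₂^* p₂^* = id`)

Layer `Literature/Geometry/Kaehler`, namespace `Literature.Geometry.Kaehler.ComplexTorus`; lane `lit-hodgefound` (Track 2
foundations library), seat p09, generation 33, row g33-#1. THEOREMS ONLY (0 definitions); no named fact, net debt 0. For complex tori
`X₁ = E₁/Φ₁(ℤ^{ι₁})` (`|ι₁| = N₁ = 2g₁`, `g₁ = dim_ℂ E₁`), `X₂ = E₂/Φ₂(ℤ^{ι₂})` and the product torus `X = X₁ × X₂ = (E₁ × E₂)/(Λ₁ ⊕ Λ₂)`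
(`prodPeriod Φ₁ Φ₂`, `ComplexTorusProduct`), the degree-`l` TRANSCENDENTAL LATTICES of g31-#11 (`ComplexTorusTranscendentalLatticeAllDegrees`;
written out exactly as there, no definition)

  `T^l_{k,p}(X₂) = Hˡ(X₂, ℤ) ∩ ⋂_{s ∈ Hdg^{k,p}(X₂, ℤ)} ker ⟨s, ·⟩_{e₂}`      (`k + l = |ι₂|`),
  `T^l_{N₁+k, g₁+p}(X) = Hˡ(X, ℤ) ∩ ⋂_{S ∈ Hdg^{N₁+k, g₁+p}(X, ℤ)} ker ⟨S, ·⟩_e`   (`N₁ + k + l = |ι₁| + |ι₂|`)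

(Huybrechts Ch. 3 §2.2: "`T(X) = NS(X)^⊥`", Shioda–Mitani's `T_X`; `⟨ , ⟩` the cup-product pairing `poincarePairing`, Lange §6.2.4
p. 310) are compared along the three maps attached to the second factor: the pull-back `p₂^* = (· ∘ pr₂)`, the Gysin map / integration
along the fibre `p_{2*} = pushforwardFst Φ₁ Φ₂ e₁ : H^{N₁+l}(X) → Hˡ(X₂)` (A4-33⁺ `ComplexTorusPushforward`, Lange (6.10), Arapura Lemma 5.5.1),
and the restriction `ι₂^* = (· ∘ (0, ·))` to the fibre `0 × X₂`. Voisin §7.3.2 (PDF pp. 149–151): `φ^*` and the Gysin morphism `φ_*` are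
morphisms of Hodge structures (of bidegrees `(0,0)` and `(r,r)`), "`(φ_*α, β)_Y = (α, φ^*β)_X`"; hence both carry integral Hodge classes to
integral Hodge classes and, by adjunction, transcendental lattices (= annihilators of the integral Hodge classes) to transcendental lattices:

* §1 ADJUNCTION for the cup-product pairings of the tree: `sign(e) ⟨S, p₂^*t⟩_e = sign(e₂) ⟨p_{2*}S, t⟩_{e₂}` and
  `sign(e) ⟨p₂^*s, T⟩_e = sign(e₂) ⟨s, p_{2*}T⟩_{e₂}` (Arapura (5.5.2), the tree's `torusIntegral_pushforwardFst_wedge` /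
  `pushforwardFst_comp_snd_wedge`; the sibling `poincarePairing_pushforwardFst_eq` of `ComplexTorusGysinFibreIntegral` is the first identity
  for factors in a common universe — re-derived here universe-polymorphically), with the `= 0 ↔ = 0` corollaries.
* §2 **`p_{2*} Hdg^{N₁+k, g₁+p}(X₁ × X₂, ℤ) ⊆ Hdg^{k,p}(X₂, ℤ)`** (and `Λ^{g₁+p, g₁+q} → Λ^{p,q}`, `B → B`): `p_{2*}` is integral
  (`pushforwardFst_mem_integralForms`) of bidegree `(−g₁, −g₁)` (`isOfTypeAt_pushforwardFst`; Voisin §7.3.2, Lange Prop. 6.2.21).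
* §3 **`p₂^* T^l_{k,p}(X₂) ⊆ T^l_{N₁+k, g₁+p}(X₁ × X₂)`**: `⟨S, p₂^*t⟩ = ± ⟨p_{2*}S, t⟩ = 0`.
* §4 **`p_{2*} T^{N₁+l}_{k,p}(X₁ × X₂) ⊆ T^l_{k,p}(X₂)`**: `⟨s, p_{2*}T⟩ = ± ⟨p₂^*s, T⟩ = 0` (`p₂^* Hdg(X₂, ℤ) ⊆ Hdg(X, ℤ)`, g31-#4).
* §5 **`ι₂^* x = p_{2*}(pr₁^* vol_{X₁} ∧ x)`** for EVERY invariant form `x` on `X₁ × X₂` (Arapura §5.5.2 Exercise 5.5.5 "`i^*β = ∫_π τ_Y ∪ β`"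
  for `Y = 0 × X₂`, `π = p₂`, Thom class `τ_Y = pr₁^* vol_{X₁}` = the class of the fibre; block evaluation of the wedge,
  `wedge_apply_append_of_forall_eq_zero`), `⟨S, pr₁^*vol ∧ x⟩ = ⟨pr₁^*vol ∧ S, x⟩`, and **`pr₁^* vol_{X₁} ∧ T^l_{N₁+k, g₁+p}(X) ⊆ T^{N₁+l}_{k,p}(X)`**.
* §6 **`ι₂^* T^l_{N₁+k, g₁+p}(X₁ × X₂) ⊆ T^l_{k,p}(X₂)`** (§5 + §4).
* §7 `ι₂^* p₂^* = id`: `p₂^*|_T : T(X₂) ↪ T(X₁ × X₂)` is a split injection of `ℤ`-modules with retraction `ι₂^*|_T`, so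
  **`rk_ℤ T^l_{k,p}(X₂) ≤ rk_ℤ T^l_{N₁+k, g₁+p}(X₁ × X₂)`**.
* §8 the lattices do not depend on the enumeration `e` of the lattice basis used for `⟨ , ⟩_e` (`⟨γ, δ⟩_e = sign(e) ∫_X γ ∧ δ`).

`-- TODO(general form)`: the first factor (`p₁^*`, `p_{1*}`, `ι₁^*`) — the tree's fibre integral is `pushforwardFst` (along `X₁` onto `X₂`)
only; the symmetric statements follow by the swap `X₁ × X₂ ≅ X₂ × X₁` and are not restated here.

## FAIL-DUP disclosure

Consumed BY NAME, not restated: `pushforwardFst`, `pushforwardFst_apply`, `pushforwardFst_mem_integralForms/rationalForms`, `isOfTypeAt_pushforwardFst`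
(A4-33⁺), `torusIntegral_pushforwardFst(_wedge)`, `pushforwardFst_comp_snd_wedge` (A4-50), `comp_snd_mem_integralHodgeClassesIn`,
`comp_inr_mem_integralForms`, `compContinuousLinearMap_snd_inr` (g31-#4), `wedge_mem_integralHodgeClassesIn` (g31-#1), `mem_integralHodgeAnnihilator_iff`,
`moduleFinite_integralHodgeAnnihilator` (g31-#11/#12), `wedge_apply_append_of_forall_eq_zero` (A4-33). The sibling `ComplexTorusGysinFibreIntegral`
(`poincarePairing_pushforwardFst_eq`, `coe_gysinMap_sndMatrix`, Hodge-structure morphism `gysinHom_sndMatrix_apply`) works on the `ℚ`-carriers in one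
universe; nothing there is about `Hdg(−, ℤ)` or the annihilators.

## References

* [cite: VoisinHodgeI2002, §7.3.2 (PDF pp. 149–151: `φ^*` morphism of HS; Lemma 7.28; Gysin morphism `φ_* = PD⁻¹ ∘ ᵗ(φ^*) ∘ PD`,
  "`φ_*` is a morphism of Hodge structures of bidegree `(r, r)`", "`(φ_*α, β)_Y = (α, φ^*β)_X`"); §11.3.1 Def. 11.28 (`Hdg(V) = V_ℤ ∩ V^{p,p}`)]
* [cite: Arapura2012, §5.5 (5.5.1), §5.5.1 Lemma 5.5.1 / (5.5.2) (p. 114), §5.5.2 Lemma 5.5.3 and Exercise 5.5.5 (p. 115: `i^*β = ∫_π τ_Y ∪ β`)]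
* [cite: Lange2023AbelianVarietiesComplex, §6.2.4 (6.10) p. 310 (`p₁^*x = x ⊗ 1`, `1 = cl(X̂)`; `p_{2*}(x ⊗ y) = d(x) y`), Prop. 6.2.21 (proof, p. 311), §6.2.1 Thm. 6.2.4 (projection formula), §7.2.2]
* [cite: Huybrechts2016K3, Ch. 3 §2.2 Def. 2.5 (PDF p. 58: `T(X)`), §2.3 (PDF p. 59)]
* [cite: ShiodaMitani1974, §1 (1.5) and §3 (3.19) (`T_X`)]
* [cite: HatcherAT2002, §3.2 Thm. 3.15 (Künneth for `H^*(X × Y; ℤ)`)]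
-/

noncomputable section

open Module Function
open Literature.LinearAlgebra.Alternating Literature.Analysis.Complex

namespace Literature.Geometry.Kaehler.ComplexTorus

section ProductProjection

variable {ι₁ ι₂ : Type*} [Fintype ι₁] [Fintype ι₂] [DecidableEq ι₁] [DecidableEq ι₂]
  {E₁ E₂ : Type*} [NormedAddCommGroup E₁] [NormedSpace ℂ E₁] [NormedAddCommGroup E₂] [NormedSpace ℂ E₂]
  (Φ₁ : (ι₁ → ℝ) ≃L[ℝ] E₁) (Φ₂ : (ι₂ → ℝ) ≃L[ℝ] E₂) {N₁ n₂ n k l : ℕ} (e₁ : Fin N₁ ≃ ι₁)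

/-! ## §1 Adjunction: `sign(e) ⟨S, p₂^*t⟩_e = sign(e₂) ⟨p_{2*}S, t⟩_{e₂}` and `sign(e) ⟨p₂^*s, T⟩_e = sign(e₂) ⟨s, p_{2*}T⟩_{e₂}` -/

omit [Fintype ι₂] [DecidableEq ι₁] in
/-- An orientation sign is a unit of `ℂ`. [cite: VoisinHodgeI2002, §11.1.2 Cor. 11.15] -/
private theorem orientationSign_cast_ne_zero₃₃ {ι E : Type*} [DecidableEq ι] [NormedAddCommGroup E] [NormedSpace ℂ E]
    (Φ : (ι → ℝ) ≃L[ℝ] E) {m : ℕ} (e : Fin m ≃ ι) : (orientationSign Φ e : ℂ) ≠ 0 := by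
  rcases orientationSign_eq_or Φ e with h | h <;> rw [h] <;> norm_num

/-- **Adjunction on the right: `sign(e) · ⟨S, p₂^*t⟩_e = sign(e₂) · ⟨p_{2*}S, t⟩_{e₂}`** for `S ∈ Alt^{N₁+k}(E₁ × E₂)`, `t ∈ Altˡ(E₂)`
(`∫_{X₁ × X₂} S ∧ p₂^*t = ∫_{X₂} p_{2*}S ∧ t`, Arapura's (5.5.2), and `∫_X γ ∧ δ = sign(e) ⟨γ, δ⟩_e`).
[cite: Arapura2012, §5.5.1 Lemma 5.5.1 (5.5.2), p. 114] [cite: VoisinHodgeI2002, §7.3.2 (PDF p. 151: `(φ_*α, β)_Y = (α, φ^*β)_X`)] -/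
theorem orientationSign_mul_poincarePairing_comp_snd_right (e₂ : Fin (k + l) ≃ ι₂) (e : Fin (N₁ + k + l) ≃ ι₁ ⊕ ι₂)
    (S : (E₁ × E₂) [⋀^Fin (N₁ + k)]→L[ℝ] ℂ) (t : E₂ [⋀^Fin l]→L[ℝ] ℂ) :
    (orientationSign (prodPeriod Φ₁ Φ₂) e : ℂ) *
        poincarePairing (prodPeriod Φ₁ Φ₂) e rfl S (t.compContinuousLinearMap (ContinuousLinearMap.snd ℝ E₁ E₂)) =
      (orientationSign Φ₂ e₂ : ℂ) * poincarePairing Φ₂ e₂ rfl (pushforwardFst Φ₁ Φ₂ e₁ S) t := by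
  have hh : N₁ + (k + l) = N₁ + k + l := (Nat.add_assoc N₁ k l).symm
  have hF := torusIntegral_pushforwardFst_wedge Φ₁ Φ₂ ((finCongr hh).trans e) e₁ e₂ S t
  rw [torusIntegral_finCongr_trans (prodPeriod Φ₁ Φ₂) e hh, domDomCongr_finCongr_trans, domDomCongr_finCongr_self,
    torusIntegral_wedge_eq_orientationSign_mul_poincarePairing',
    torusIntegral_wedge_eq_orientationSign_mul_poincarePairing'] at hF
  exact hF.symm

/-- **Adjunction on the left: `sign(e) · ⟨p₂^*s, T⟩_e = sign(e₂) · ⟨s, p_{2*}T⟩_{e₂}`** for `s ∈ Altᵏ(E₂)`, `T ∈ Alt^{N₁+l}(E₁ × E₂)`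
(projection formula on the left `p_{2*}(p₂^*s ∧ T) = s ∧ p_{2*}T`, no sign since the fibre is even-dimensional, then
`∫_{X₂} ∘ p_{2*} = ∫_{X₁ × X₂}`). [cite: Arapura2012, §5.5.1 Lemma 5.5.1 (5.5.2), p. 114] [cite: Lange2023AbelianVarietiesComplex, §6.2.1 Thm. 6.2.4 p. 302] -/
theorem orientationSign_mul_poincarePairing_comp_snd_left (e₂ : Fin (k + l) ≃ ι₂) (e : Fin (k + (N₁ + l)) ≃ ι₁ ⊕ ι₂)
    (s : E₂ [⋀^Fin k]→L[ℝ] ℂ) (T : (E₁ × E₂) [⋀^Fin (N₁ + l)]→L[ℝ] ℂ) :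
    (orientationSign (prodPeriod Φ₁ Φ₂) e : ℂ) *
        poincarePairing (prodPeriod Φ₁ Φ₂) e rfl (s.compContinuousLinearMap (ContinuousLinearMap.snd ℝ E₁ E₂)) T =
      (orientationSign Φ₂ e₂ : ℂ) * poincarePairing Φ₂ e₂ rfl s (pushforwardFst Φ₁ Φ₂ e₁ T) := by
  have hh : N₁ + (k + l) = k + (N₁ + l) := by omega
  have hP := pushforwardFst_comp_snd_wedge Φ₁ Φ₂ e₁ s T (l := l) (k := k)
  have hI := torusIntegral_pushforwardFst Φ₁ Φ₂ ((finCongr hh).trans e) e₁ e₂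
    (((s.compContinuousLinearMap (ContinuousLinearMap.snd ℝ E₁ E₂)).wedge T).domDomCongr
      (finCongr (by omega : k + (N₁ + l) = N₁ + (k + l))))
  rw [hP, torusIntegral_finCongr_trans (prodPeriod Φ₁ Φ₂) e hh, domDomCongr_finCongr_trans, domDomCongr_finCongr_self,
    torusIntegral_wedge_eq_orientationSign_mul_poincarePairing',
    torusIntegral_wedge_eq_orientationSign_mul_poincarePairing'] at hI
  exact hI.symm

/-- `⟨S, p₂^*t⟩_e = 0 ⟺ ⟨p_{2*}S, t⟩_{e₂} = 0`. [cite: Arapura2012, §5.5.1 Lemma 5.5.1 (5.5.2), p. 114] -/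
theorem poincarePairing_comp_snd_right_eq_zero_iff (e₂ : Fin (k + l) ≃ ι₂) (e : Fin (N₁ + k + l) ≃ ι₁ ⊕ ι₂)
    (S : (E₁ × E₂) [⋀^Fin (N₁ + k)]→L[ℝ] ℂ) (t : E₂ [⋀^Fin l]→L[ℝ] ℂ) :
    poincarePairing (prodPeriod Φ₁ Φ₂) e rfl S (t.compContinuousLinearMap (ContinuousLinearMap.snd ℝ E₁ E₂)) = 0 ↔
      poincarePairing Φ₂ e₂ rfl (pushforwardFst Φ₁ Φ₂ e₁ S) t = 0 := by
  have h := orientationSign_mul_poincarePairing_comp_snd_right Φ₁ Φ₂ e₁ e₂ e S t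
  constructor <;> intro h0
  · rw [h0, mul_zero] at h
    exact (mul_eq_zero.1 h.symm).resolve_left (orientationSign_cast_ne_zero₃₃ Φ₂ e₂)
  · rw [h0, mul_zero] at h
    exact (mul_eq_zero.1 h).resolve_left (orientationSign_cast_ne_zero₃₃ (prodPeriod Φ₁ Φ₂) e)

/-- `⟨p₂^*s, T⟩_e = 0 ⟺ ⟨s, p_{2*}T⟩_{e₂} = 0`. [cite: Arapura2012, §5.5.1 Lemma 5.5.1 (5.5.2), p. 114] -/
theorem poincarePairing_comp_snd_left_eq_zero_iff (e₂ : Fin (k + l) ≃ ι₂) (e : Fin (k + (N₁ + l)) ≃ ι₁ ⊕ ι₂)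
    (s : E₂ [⋀^Fin k]→L[ℝ] ℂ) (T : (E₁ × E₂) [⋀^Fin (N₁ + l)]→L[ℝ] ℂ) :
    poincarePairing (prodPeriod Φ₁ Φ₂) e rfl (s.compContinuousLinearMap (ContinuousLinearMap.snd ℝ E₁ E₂)) T = 0 ↔
      poincarePairing Φ₂ e₂ rfl s (pushforwardFst Φ₁ Φ₂ e₁ T) = 0 := by
  have h := orientationSign_mul_poincarePairing_comp_snd_left Φ₁ Φ₂ e₁ e₂ e s T
  constructor <;> intro h0
  · rw [h0, mul_zero] at h
    exact (mul_eq_zero.1 h.symm).resolve_left (orientationSign_cast_ne_zero₃₃ Φ₂ e₂)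
  · rw [h0, mul_zero] at h
    exact (mul_eq_zero.1 h).resolve_left (orientationSign_cast_ne_zero₃₃ (prodPeriod Φ₁ Φ₂) e)

/-! ## §2 `p_{2*}` carries (integral, rational) Hodge classes of `X₁ × X₂` to Hodge classes of `X₂` -/

/-- **`p_{2*} Λ^{g₁+p, g₁+q}(X₁ × X₂) ⊆ Λ^{p,q}(X₂)`** (`g₁ = dim_ℂ X₁`): integration along the fibre has bidegree `(−g₁, −g₁)`
(the tree's pointwise `isOfTypeAt_pushforwardFst`; off the diagonal `p + q = k` both type submodules are zero).
[cite: VoisinHodgeI2002, §7.3.2 (PDF p. 151: "`φ_*` is a morphism of Hodge structures of bidegree `(r, r)`")] [cite: Lange2023AbelianVarietiesComplex, §6.2.4 Prop. 6.2.21 (proof) p. 311] -/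
theorem pushforwardFst_mem_typeSubmodule {g₁ p q : ℕ} (hg₁ : finrank ℂ E₁ = g₁) {S : (E₁ × E₂) [⋀^Fin (N₁ + k)]→L[ℝ] ℂ}
    (hS : S ∈ typeSubmodule (E₁ × E₂) (N₁ + k) (g₁ + p) (g₁ + q)) :
    pushforwardFst Φ₁ Φ₂ e₁ S ∈ typeSubmodule E₂ k p q := by
  have h2 : finrank ℂ E₁ * 2 = N₁ := finrank_complex_mul_two Φ₁ e₁
  by_cases hk : p + q = k
  · have hS' : IsOfTypeAt (g₁ + p) (g₁ + q) S := (mem_typeSubmodule_iff_isOfTypeAt (by omega)).1 hS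
    exact (isOfTypeAt_pushforwardFst Φ₁ Φ₂ e₁ hS' (p' := p) (q' := q) (by omega) (by omega)).mem_typeSubmodule
  · have hS0 : S = 0 := by
      have h := mem_typeSubmodule_iff.1 hS
      rw [typeProjAt_of_ne (by omega)] at h
      exact h.symm
    rw [hS0, pushforwardFst_zero]
    exact Submodule.zero_mem _

/-- **`p_{2*} Hdg^{N₁+k, g₁+p}(X₁ × X₂, ℤ) ⊆ Hdg^{k,p}(X₂, ℤ)`**: the Gysin map of the projection carries integral Hodge classes to integral
Hodge classes (integral: `pushforwardFst_mem_integralForms`; type: bidegree `(−g₁, −g₁)`).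
[cite: VoisinHodgeI2002, §7.3.2 (PDF pp. 150–151) and §11.3.1 Def. 11.28] [cite: Lange2023AbelianVarietiesComplex, §6.2.4 (6.10) p. 310 and §7.2.2] -/
theorem pushforwardFst_mem_integralHodgeClassesIn {g₁ p : ℕ} (hg₁ : finrank ℂ E₁ = g₁) {S : (E₁ × E₂) [⋀^Fin (N₁ + k)]→L[ℝ] ℂ}
    (hS : S ∈ integralHodgeClassesIn (prodPeriod Φ₁ Φ₂) (N₁ + k) (g₁ + p)) :
    pushforwardFst Φ₁ Φ₂ e₁ S ∈ integralHodgeClassesIn Φ₂ k p :=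
  (mem_integralHodgeClassesIn_iff Φ₂).2
    ⟨pushforwardFst_mem_integralForms Φ₁ Φ₂ e₁ ((mem_integralHodgeClassesIn_iff _).1 hS).1,
      pushforwardFst_mem_typeSubmodule Φ₁ Φ₂ e₁ hg₁ ((mem_integralHodgeClassesIn_iff _).1 hS).2⟩

/-- **`p_{2*} B^{N₁+k, g₁+p}(X₁ × X₂) ⊆ B^{k,p}(X₂)`**: the same for rational Hodge classes.
[cite: VoisinHodgeI2002, §7.3.2 (PDF pp. 150–151)] [cite: Lange2023AbelianVarietiesComplex, §7.2.2] -/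
theorem pushforwardFst_mem_hodgeClassesIn {g₁ p : ℕ} (hg₁ : finrank ℂ E₁ = g₁) {S : (E₁ × E₂) [⋀^Fin (N₁ + k)]→L[ℝ] ℂ}
    (hS : S ∈ hodgeClassesIn (prodPeriod Φ₁ Φ₂) (N₁ + k) (g₁ + p)) :
    pushforwardFst Φ₁ Φ₂ e₁ S ∈ hodgeClassesIn Φ₂ k p :=
  (mem_hodgeClassesIn_iff Φ₂).2
    ⟨pushforwardFst_mem_rationalForms Φ₁ Φ₂ e₁ ((mem_hodgeClassesIn_iff _).1 hS).1,
      pushforwardFst_mem_typeSubmodule Φ₁ Φ₂ e₁ hg₁ ((mem_hodgeClassesIn_iff _).1 hS).2⟩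

/-! ## §3 Pull-back: `p₂^* T^l_{k,p}(X₂) ⊆ T^l_{N₁+k, g₁+p}(X₁ × X₂)` -/

include e₁ in
/-- **`p₂^* T^l_{k,p}(X₂) ⊆ T^l_{N₁+k, g₁+p}(X₁ × X₂)`**: for `t ∈ Hˡ(X₂, ℤ)` annihilating `Hdg^{k,p}(X₂, ℤ)`, the class `p₂^*t ∈ Hˡ(X₁ × X₂, ℤ)`
annihilates `Hdg^{N₁+k, g₁+p}(X₁ × X₂, ℤ)`: `⟨S, p₂^*t⟩ = ± ⟨p_{2*}S, t⟩ = 0` since `p_{2*}S ∈ Hdg^{k,p}(X₂, ℤ)` (§2) — the pull-back along the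
(surjective) projection is a morphism of Hodge structures, injective on cohomology (Voisin Lemma 7.28), and respects the transcendental lattices.
[cite: VoisinHodgeI2002, §7.3.2 Lemma 7.28 and PDF p. 151] [cite: Huybrechts2016K3, Ch. 3 §2.2 Def. 2.5 (PDF p. 58)] -/
theorem comp_snd_mem_integralHodgeAnnihilator (e₂ : Fin n₂ ≃ ι₂) (e : Fin n ≃ ι₁ ⊕ ι₂) (h₂ : k + l = n₂) (H : N₁ + k + l = n)
    {g₁ : ℕ} (hg₁ : finrank ℂ E₁ = g₁) (p : ℕ) {t : E₂ [⋀^Fin l]→L[ℝ] ℂ}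
    (ht : t ∈ integralForms Φ₂ l ⊓ ⨅ s : integralHodgeClassesIn Φ₂ k p,
        (LinearMap.ker (poincarePairing Φ₂ e₂ h₂ (s : E₂ [⋀^Fin k]→L[ℝ] ℂ))).toAddSubgroup) :
    t.compContinuousLinearMap (ContinuousLinearMap.snd ℝ E₁ E₂) ∈
      integralForms (prodPeriod Φ₁ Φ₂) l ⊓ ⨅ S : integralHodgeClassesIn (prodPeriod Φ₁ Φ₂) (N₁ + k) (g₁ + p),
        (LinearMap.ker (poincarePairing (prodPeriod Φ₁ Φ₂) e H (S : (E₁ × E₂) [⋀^Fin (N₁ + k)]→L[ℝ] ℂ))).toAddSubgroup := by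
  subst h₂ H
  rw [mem_integralHodgeAnnihilator_iff] at ht ⊢
  refine ⟨comp_snd_mem_integralForms Φ₁ Φ₂ ht.1, fun S hS ↦ ?_⟩
  rw [poincarePairing_comp_snd_right_eq_zero_iff Φ₁ Φ₂ e₁ e₂ e S t]
  exact ht.2 _ (pushforwardFst_mem_integralHodgeClassesIn Φ₁ Φ₂ e₁ hg₁ hS)

include e₁ in
/-- **`p₂^*|_T : T^l_{k,p}(X₂) → T^l_{N₁+k, g₁+p}(X₁ × X₂)` as an injective `ℤ`-linear map** (`p₂^*` is injective on all of `Hˡ`, left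
inverse `ι₂^*`). [cite: VoisinHodgeI2002, §7.3.2 Lemma 7.28] [cite: HatcherAT2002, §3.2 Thm. 3.15] -/
theorem exists_intLinearMap_integralHodgeAnnihilator_comp_snd (e₂ : Fin n₂ ≃ ι₂) (e : Fin n ≃ ι₁ ⊕ ι₂) (h₂ : k + l = n₂)
    (H : N₁ + k + l = n) {g₁ : ℕ} (hg₁ : finrank ℂ E₁ = g₁) (p : ℕ) :
    ∃ P : ↥(integralForms Φ₂ l ⊓ ⨅ s : integralHodgeClassesIn Φ₂ k p,
          (LinearMap.ker (poincarePairing Φ₂ e₂ h₂ (s : E₂ [⋀^Fin k]→L[ℝ] ℂ))).toAddSubgroup) →ₗ[ℤ]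
        ↥(integralForms (prodPeriod Φ₁ Φ₂) l ⊓ ⨅ S : integralHodgeClassesIn (prodPeriod Φ₁ Φ₂) (N₁ + k) (g₁ + p),
          (LinearMap.ker (poincarePairing (prodPeriod Φ₁ Φ₂) e H (S : (E₁ × E₂) [⋀^Fin (N₁ + k)]→L[ℝ] ℂ))).toAddSubgroup),
      (∀ t, (P t : (E₁ × E₂) [⋀^Fin l]→L[ℝ] ℂ) =
          (t : E₂ [⋀^Fin l]→L[ℝ] ℂ).compContinuousLinearMap (ContinuousLinearMap.snd ℝ E₁ E₂)) ∧ Injective P := by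
  refine ⟨(AddMonoidHom.mk' (fun t ↦ ⟨(t : E₂ [⋀^Fin l]→L[ℝ] ℂ).compContinuousLinearMap (ContinuousLinearMap.snd ℝ E₁ E₂),
      comp_snd_mem_integralHodgeAnnihilator Φ₁ Φ₂ e₁ e₂ e h₂ H hg₁ p t.2⟩) fun _ _ ↦ Subtype.ext (by ext v; rfl)).toIntLinearMap,
    fun _ ↦ rfl, fun t t' htt ↦ Subtype.ext (compContinuousLinearMap_snd_injective (E₁ := E₁) l ?_)⟩
  exact congrArg (fun z : ↥(integralForms (prodPeriod Φ₁ Φ₂) l ⊓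
    ⨅ S : integralHodgeClassesIn (prodPeriod Φ₁ Φ₂) (N₁ + k) (g₁ + p),
      (LinearMap.ker (poincarePairing (prodPeriod Φ₁ Φ₂) e H (S : (E₁ × E₂) [⋀^Fin (N₁ + k)]→L[ℝ] ℂ))).toAddSubgroup) ↦
        (z : (E₁ × E₂) [⋀^Fin l]→L[ℝ] ℂ)) htt

/-! ## §4 Push-forward: `p_{2*} T^{N₁+l}_{k,p}(X₁ × X₂) ⊆ T^l_{k,p}(X₂)` -/

/-- **`p_{2*} T^{N₁+l}_{k,p}(X₁ × X₂) ⊆ T^l_{k,p}(X₂)`**: for `T ∈ H^{N₁+l}(X₁ × X₂, ℤ)` annihilating `Hdg^{k,p}(X₁ × X₂, ℤ)`, its fibre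
integral `p_{2*}T ∈ Hˡ(X₂, ℤ)` annihilates `Hdg^{k,p}(X₂, ℤ)`: `⟨s, p_{2*}T⟩ = ± ⟨p₂^*s, T⟩ = 0` because `p₂^*s ∈ Hdg^{k,p}(X₁ × X₂, ℤ)`
(g31-#4 `comp_snd_mem_integralHodgeClassesIn`) — the Gysin morphism is a morphism of Hodge structures and respects the transcendental lattices.
[cite: VoisinHodgeI2002, §7.3.2 (PDF pp. 150–151)] [cite: Arapura2012, §5.5.1 Lemma 5.5.1, p. 114] [cite: Huybrechts2016K3, Ch. 3 §2.2 Def. 2.5 (PDF p. 58)] -/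
theorem pushforwardFst_mem_integralHodgeAnnihilator (e₂ : Fin n₂ ≃ ι₂) (e : Fin n ≃ ι₁ ⊕ ι₂) (h₂ : k + l = n₂)
    (H' : k + (N₁ + l) = n) (p : ℕ) {T : (E₁ × E₂) [⋀^Fin (N₁ + l)]→L[ℝ] ℂ}
    (hT : T ∈ integralForms (prodPeriod Φ₁ Φ₂) (N₁ + l) ⊓ ⨅ S : integralHodgeClassesIn (prodPeriod Φ₁ Φ₂) k p,
        (LinearMap.ker (poincarePairing (prodPeriod Φ₁ Φ₂) e H' (S : (E₁ × E₂) [⋀^Fin k]→L[ℝ] ℂ))).toAddSubgroup) :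
    pushforwardFst Φ₁ Φ₂ e₁ T ∈ integralForms Φ₂ l ⊓ ⨅ s : integralHodgeClassesIn Φ₂ k p,
        (LinearMap.ker (poincarePairing Φ₂ e₂ h₂ (s : E₂ [⋀^Fin k]→L[ℝ] ℂ))).toAddSubgroup := by
  subst h₂ H'
  rw [mem_integralHodgeAnnihilator_iff] at hT ⊢
  refine ⟨pushforwardFst_mem_integralForms Φ₁ Φ₂ e₁ hT.1, fun s hs ↦ ?_⟩
  rw [← poincarePairing_comp_snd_left_eq_zero_iff Φ₁ Φ₂ e₁ e₂ e s T]
  exact hT.2 _ (comp_snd_mem_integralHodgeClassesIn Φ₁ Φ₂ hs)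

/-- **`p_{2*}|_T : T^{N₁+l}_{k,p}(X₁ × X₂) → T^l_{k,p}(X₂)` as a `ℤ`-linear map.** [cite: VoisinHodgeI2002, §7.3.2 (PDF pp. 150–151)] -/
theorem exists_intLinearMap_integralHodgeAnnihilator_pushforwardFst (e₂ : Fin n₂ ≃ ι₂) (e : Fin n ≃ ι₁ ⊕ ι₂) (h₂ : k + l = n₂)
    (H' : k + (N₁ + l) = n) (p : ℕ) :
    ∃ G : ↥(integralForms (prodPeriod Φ₁ Φ₂) (N₁ + l) ⊓ ⨅ S : integralHodgeClassesIn (prodPeriod Φ₁ Φ₂) k p,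
          (LinearMap.ker (poincarePairing (prodPeriod Φ₁ Φ₂) e H' (S : (E₁ × E₂) [⋀^Fin k]→L[ℝ] ℂ))).toAddSubgroup) →ₗ[ℤ]
        ↥(integralForms Φ₂ l ⊓ ⨅ s : integralHodgeClassesIn Φ₂ k p,
          (LinearMap.ker (poincarePairing Φ₂ e₂ h₂ (s : E₂ [⋀^Fin k]→L[ℝ] ℂ))).toAddSubgroup),
      ∀ T, (G T : E₂ [⋀^Fin l]→L[ℝ] ℂ) = pushforwardFst Φ₁ Φ₂ e₁ (T : (E₁ × E₂) [⋀^Fin (N₁ + l)]→L[ℝ] ℂ) :=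
  ⟨(AddMonoidHom.mk' (fun T ↦ ⟨pushforwardFst Φ₁ Φ₂ e₁ (T : (E₁ × E₂) [⋀^Fin (N₁ + l)]→L[ℝ] ℂ),
      pushforwardFst_mem_integralHodgeAnnihilator Φ₁ Φ₂ e₁ e₂ e h₂ H' p T.2⟩)
      fun _ _ ↦ Subtype.ext (pushforwardFst_add Φ₁ Φ₂ e₁ _ _)).toIntLinearMap, fun _ ↦ rfl⟩

/-! ## §5 Restriction to the fibre `0 × X₂`: `ι₂^* = p_{2*}(pr₁^* vol_{X₁} ∧ ·)` and `pr₁^* vol_{X₁} ∧ T ⊆ T` -/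

/-- **`ι₂^* x = p_{2*}(pr₁^* vol_{X₁} ∧ x)`** for every invariant `l`-form `x` on `X₁ × X₂` (`ι₂ = (0, ·) : X₂ → X₁ × X₂` the fibre of `p₁` over
`0`, `pr₁^* vol_{X₁}` the class of a fibre of `p₁` = the Thom class of `0 × X₂`): Arapura's "`i^*β = ∫_π τ_Y ∪ β`" with `π = p₂`,
`τ_Y = pr₁^* vol_{X₁}`; on frames `(p_{2*}(pr₁^*vol ∧ x))(w) = sign(e₁) (pr₁^*vol ∧ x)((λ¹, 0) ++ (0, w)) = sign(e₁) vol(λ¹) · x((0, w)) = x((0, w))`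
by block evaluation (`pr₁^* vol` kills every tuple containing a vector `(0, w_j)`).
[cite: Arapura2012, §5.5.2 Lemma 5.5.3 and Exercise 5.5.5, p. 115] [cite: Lange2023AbelianVarietiesComplex, §6.2.4 (6.10) p. 310] -/
theorem compContinuousLinearMap_inr_eq_pushforwardFst_volumeForm_wedge (x : (E₁ × E₂) [⋀^Fin l]→L[ℝ] ℂ) :
    x.compContinuousLinearMap (ContinuousLinearMap.inr ℝ E₁ E₂) =
      pushforwardFst Φ₁ Φ₂ e₁ (((volumeForm Φ₁ e₁).compContinuousLinearMap (ContinuousLinearMap.fst ℝ E₁ E₂)).wedge x) := by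
  ext w
  rw [pushforwardFst_apply, Literature.Geometry.Kaehler.wedge_apply_append_of_forall_eq_zero]
  · have h1 : ((volumeForm Φ₁ e₁).compContinuousLinearMap (ContinuousLinearMap.fst ℝ E₁ E₂))
        (fun j ↦ ((latticeFrame Φ₁ e₁ j, 0) : E₁ × E₂)) = volumeForm Φ₁ e₁ (latticeFrame Φ₁ e₁) := rfl
    have h2 : x (fun j ↦ ((0, w j) : E₁ × E₂)) = x.compContinuousLinearMap (ContinuousLinearMap.inr ℝ E₁ E₂) w := rfl
    have hs : (orientationSign Φ₁ e₁ : ℂ) * (orientationSign Φ₁ e₁ : ℂ) = 1 := by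
      exact_mod_cast orientationSign_mul_self Φ₁ e₁
    rw [h1, h2, volumeForm_apply_latticeFrame, ← mul_assoc, hs, one_mul]
  · intro w' i j hw
    rw [ContinuousAlternatingMap.compContinuousLinearMap_apply]
    exact ContinuousAlternatingMap.map_coord_zero _ i (by simp [hw])

/-- **`⟨S, pr₁^*vol ∧ x⟩_e = ⟨pr₁^*vol ∧ S, x⟩_e`**: the (even-degree) class `pr₁^* vol_{X₁}` moves across the cup-product pairing
(`S ∧ (V ∧ x) = (S ∧ V) ∧ x = (V ∧ S) ∧ x`, associativity and graded commutativity with `deg V = N₁ = 2g₁` even; the reindexing casts do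
not change the lattice tuple the pairing evaluates on). [cite: Lange2023AbelianVarietiesComplex, §6.2.4 (p. 310) and §1.4.1 (p. 37)] -/
theorem poincarePairing_comp_fst_volumeForm_wedge_right (e : Fin n ≃ ι₁ ⊕ ι₂) (H' : k + (N₁ + l) = n) (H : N₁ + k + l = n)
    (S : (E₁ × E₂) [⋀^Fin k]→L[ℝ] ℂ) (x : (E₁ × E₂) [⋀^Fin l]→L[ℝ] ℂ) :
    poincarePairing (prodPeriod Φ₁ Φ₂) e H' S
        (((volumeForm Φ₁ e₁).compContinuousLinearMap (ContinuousLinearMap.fst ℝ E₁ E₂)).wedge x) =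
      poincarePairing (prodPeriod Φ₁ Φ₂) e H
        (((volumeForm Φ₁ e₁).compContinuousLinearMap (ContinuousLinearMap.fst ℝ E₁ E₂)).wedge S) x := by
  set V := (volumeForm Φ₁ e₁).compContinuousLinearMap (ContinuousLinearMap.fst ℝ E₁ E₂) with hV
  simp only [poincarePairing, LinearMap.mk₂_apply]
  have hA := ContinuousAlternatingMap.WedgeAssoc_holds ℝ (E₁ × E₂) ℂ S V x
  have hC : S.wedge V = (V.wedge S).domDomCongr (finCongr (Nat.add_comm N₁ k)) := by
    rw [ContinuousAlternatingMap.WedgeComm_holds ℝ (E₁ × E₂) ℂ V S]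
    have h1 : (-1 : ℝ) ^ (N₁ * k) = 1 := by
      rw [← finrank_complex_mul_two Φ₁ e₁, mul_comm (finrank ℂ E₁) 2, mul_assoc, pow_mul, neg_one_sq, one_pow]
    rw [h1, one_smul]
  rw [hC, domDomCongr_finCongr_wedge] at hA
  have hev := congrArg (fun φ : (E₁ × E₂) [⋀^Fin (k + N₁ + l)]→L[ℝ] ℂ ↦
    φ (orderedBasis (prodPeriod Φ₁ Φ₂) e ∘ Fin.cast (by omega : k + N₁ + l = n))) hA
  simp only [ContinuousAlternatingMap.domDomCongr_apply] at hev
  convert hev.symm using 2 <;> exact funext fun i ↦ rfl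

omit [Fintype ι₂] [DecidableEq ι₂] in
/-- `vol_{X₁} ∈ Hdg^{N₁, g₁}(X₁, ℤ)`: the point class is an integral Hodge class (integral, `volumeForm_mem_integralForms`; of type `(g₁, g₁)` as
every top-degree form, `isOfTypeAt_self_of_finrank_add`). [cite: Lange2023AbelianVarietiesComplex, §6.2.4 p. 310 and §7.2.2] -/
theorem volumeForm_mem_integralHodgeClassesIn {g₁ : ℕ} (hg₁ : finrank ℂ E₁ = g₁) :
    volumeForm Φ₁ e₁ ∈ integralHodgeClassesIn Φ₁ N₁ g₁ := by
  have h2 : finrank ℂ E₁ * 2 = N₁ := finrank_complex_mul_two Φ₁ e₁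
  haveI := finiteDimensional_real Φ₁ e₁
  haveI : FiniteDimensional ℂ E₁ := Module.Finite.of_restrictScalars_finite ℝ ℂ E₁
  refine (mem_integralHodgeClassesIn_iff Φ₁).2 ⟨volumeForm_mem_integralForms Φ₁ e₁, ?_⟩
  have ht := isOfTypeAt_self_of_finrank_add (E := E₁) (n := N₁) (by omega) (volumeForm Φ₁ e₁)
  rw [hg₁] at ht
  exact ht.mem_typeSubmodule

/-- **`pr₁^* vol_{X₁} ∧ T^l_{N₁+k, g₁+p}(X₁ × X₂) ⊆ T^{N₁+l}_{k,p}(X₁ × X₂)`**: cup product with the class of a fibre of `p₁` carries classes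
annihilating `Hdg^{N₁+k, g₁+p}(X, ℤ)` to classes annihilating `Hdg^{k,p}(X, ℤ)` (`⟨S, V ∧ x⟩ = ⟨V ∧ S, x⟩ = 0`, as
`V ∧ S ∈ Hdg^{N₁+k, g₁+p}(X, ℤ)` for `S ∈ Hdg^{k,p}(X, ℤ)`: g31-#1 `wedge_mem_integralHodgeClassesIn`, `V = pr₁^*vol ∈ Hdg^{N₁,g₁}(X, ℤ)`).
[cite: Lange2023AbelianVarietiesComplex, §6.2.4 (6.10) p. 310 and §7.2.2] [cite: Huybrechts2016K3, Ch. 3 §2.2 Def. 2.5 (PDF p. 58)] -/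
theorem comp_fst_volumeForm_wedge_mem_integralHodgeAnnihilator (e : Fin n ≃ ι₁ ⊕ ι₂) (H : N₁ + k + l = n) (H' : k + (N₁ + l) = n)
    {g₁ : ℕ} (hg₁ : finrank ℂ E₁ = g₁) (p : ℕ) {x : (E₁ × E₂) [⋀^Fin l]→L[ℝ] ℂ}
    (hx : x ∈ integralForms (prodPeriod Φ₁ Φ₂) l ⊓ ⨅ S : integralHodgeClassesIn (prodPeriod Φ₁ Φ₂) (N₁ + k) (g₁ + p),
        (LinearMap.ker (poincarePairing (prodPeriod Φ₁ Φ₂) e H (S : (E₁ × E₂) [⋀^Fin (N₁ + k)]→L[ℝ] ℂ))).toAddSubgroup) :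
    ((volumeForm Φ₁ e₁).compContinuousLinearMap (ContinuousLinearMap.fst ℝ E₁ E₂)).wedge x ∈
      integralForms (prodPeriod Φ₁ Φ₂) (N₁ + l) ⊓ ⨅ S : integralHodgeClassesIn (prodPeriod Φ₁ Φ₂) k p,
        (LinearMap.ker (poincarePairing (prodPeriod Φ₁ Φ₂) e H' (S : (E₁ × E₂) [⋀^Fin k]→L[ℝ] ℂ))).toAddSubgroup := by
  rw [mem_integralHodgeAnnihilator_iff] at hx ⊢
  refine ⟨wedge_mem_integralForms _ (comp_fst_mem_integralForms Φ₁ Φ₂ (volumeForm_mem_integralForms Φ₁ e₁)) hx.1,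
    fun S hS ↦ ?_⟩
  rw [poincarePairing_comp_fst_volumeForm_wedge_right Φ₁ Φ₂ e₁ e H' H S x]
  exact hx.2 _ (wedge_mem_integralHodgeClassesIn _
    (comp_fst_mem_integralHodgeClassesIn Φ₁ Φ₂ (volumeForm_mem_integralHodgeClassesIn Φ₁ e₁ hg₁)) hS)

/-! ## §6 Restriction: `ι₂^* T^l_{N₁+k, g₁+p}(X₁ × X₂) ⊆ T^l_{k,p}(X₂)` -/

include e₁ in
/-- **`ι₂^* T^l_{N₁+k, g₁+p}(X₁ × X₂) ⊆ T^l_{k,p}(X₂)`**: restriction to the fibre `0 × X₂` carries the degree-`l` transcendental lattice of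
the product (annihilator of `Hdg^{N₁+k, g₁+p}(X₁ × X₂, ℤ)`) into that of the factor (annihilator of `Hdg^{k,p}(X₂, ℤ)`):
`ι₂^* = p_{2*}(pr₁^*vol ∧ ·)` (§5) followed by §4. [cite: VoisinHodgeI2002, §7.3.2 (PDF pp. 150–151)] [cite: Arapura2012, §5.5.2 Exercise 5.5.5, p. 115] [cite: Huybrechts2016K3, Ch. 3 §2.2 Def. 2.5 (PDF p. 58)] -/
theorem compContinuousLinearMap_inr_mem_integralHodgeAnnihilator (e₂ : Fin n₂ ≃ ι₂) (e : Fin n ≃ ι₁ ⊕ ι₂) (h₂ : k + l = n₂)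
    (H : N₁ + k + l = n) {g₁ : ℕ} (hg₁ : finrank ℂ E₁ = g₁) (p : ℕ) {x : (E₁ × E₂) [⋀^Fin l]→L[ℝ] ℂ}
    (hx : x ∈ integralForms (prodPeriod Φ₁ Φ₂) l ⊓ ⨅ S : integralHodgeClassesIn (prodPeriod Φ₁ Φ₂) (N₁ + k) (g₁ + p),
        (LinearMap.ker (poincarePairing (prodPeriod Φ₁ Φ₂) e H (S : (E₁ × E₂) [⋀^Fin (N₁ + k)]→L[ℝ] ℂ))).toAddSubgroup) :
    x.compContinuousLinearMap (ContinuousLinearMap.inr ℝ E₁ E₂) ∈ integralForms Φ₂ l ⊓ ⨅ s : integralHodgeClassesIn Φ₂ k p,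
        (LinearMap.ker (poincarePairing Φ₂ e₂ h₂ (s : E₂ [⋀^Fin k]→L[ℝ] ℂ))).toAddSubgroup := by
  rw [compContinuousLinearMap_inr_eq_pushforwardFst_volumeForm_wedge Φ₁ Φ₂ e₁ x]
  exact pushforwardFst_mem_integralHodgeAnnihilator Φ₁ Φ₂ e₁ e₂ e h₂ (by omega) p
    (comp_fst_volumeForm_wedge_mem_integralHodgeAnnihilator Φ₁ Φ₂ e₁ e H (by omega) hg₁ p hx)

/-! ## §7 `ι₂^* p₂^* = id`: `T(X₂)` is a direct summand of `T(X₁ × X₂)`; `rk T(X₂) ≤ rk T(X₁ × X₂)` -/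

include e₁ in
/-- **`ι₂^*|_T : T^l_{N₁+k, g₁+p}(X₁ × X₂) → T^l_{k,p}(X₂)` is a SURJECTIVE `ℤ`-linear map** (right inverse `p₂^*|_T`, `ι₂^* p₂^* = id`).
[cite: HatcherAT2002, §3.2 Thm. 3.15] [cite: VoisinHodgeI2002, §7.3.2 (PDF pp. 150–151)] -/
theorem exists_intLinearMap_integralHodgeAnnihilator_comp_inr (e₂ : Fin n₂ ≃ ι₂) (e : Fin n ≃ ι₁ ⊕ ι₂) (h₂ : k + l = n₂)
    (H : N₁ + k + l = n) {g₁ : ℕ} (hg₁ : finrank ℂ E₁ = g₁) (p : ℕ) :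
    ∃ R : ↥(integralForms (prodPeriod Φ₁ Φ₂) l ⊓ ⨅ S : integralHodgeClassesIn (prodPeriod Φ₁ Φ₂) (N₁ + k) (g₁ + p),
          (LinearMap.ker (poincarePairing (prodPeriod Φ₁ Φ₂) e H (S : (E₁ × E₂) [⋀^Fin (N₁ + k)]→L[ℝ] ℂ))).toAddSubgroup) →ₗ[ℤ]
        ↥(integralForms Φ₂ l ⊓ ⨅ s : integralHodgeClassesIn Φ₂ k p,
          (LinearMap.ker (poincarePairing Φ₂ e₂ h₂ (s : E₂ [⋀^Fin k]→L[ℝ] ℂ))).toAddSubgroup),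
      (∀ x, (R x : E₂ [⋀^Fin l]→L[ℝ] ℂ) =
          (x : (E₁ × E₂) [⋀^Fin l]→L[ℝ] ℂ).compContinuousLinearMap (ContinuousLinearMap.inr ℝ E₁ E₂)) ∧ Surjective R := by
  refine ⟨(AddMonoidHom.mk' (fun x ↦ ⟨(x : (E₁ × E₂) [⋀^Fin l]→L[ℝ] ℂ).compContinuousLinearMap (ContinuousLinearMap.inr ℝ E₁ E₂),
      compContinuousLinearMap_inr_mem_integralHodgeAnnihilator Φ₁ Φ₂ e₁ e₂ e h₂ H hg₁ p x.2⟩)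
      fun _ _ ↦ Subtype.ext (by ext v; rfl)).toIntLinearMap, fun _ ↦ rfl, fun t ↦ ?_⟩
  refine ⟨⟨(t : E₂ [⋀^Fin l]→L[ℝ] ℂ).compContinuousLinearMap (ContinuousLinearMap.snd ℝ E₁ E₂),
    comp_snd_mem_integralHodgeAnnihilator Φ₁ Φ₂ e₁ e₂ e h₂ H hg₁ p t.2⟩, Subtype.ext ?_⟩
  exact compContinuousLinearMap_snd_inr (E₁ := E₁) (t : E₂ [⋀^Fin l]→L[ℝ] ℂ)

include e₁ in
/-- **`rk_ℤ T^l_{k,p}(X₂) ≤ rk_ℤ T^l_{N₁+k, g₁+p}(X₁ × X₂)`**: the degree-`l` transcendental lattice of a factor embeds (by `p₂^*`, split by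
`ι₂^*`) into that of the product. [cite: VoisinHodgeI2002, §7.3.2 Lemma 7.28] [cite: Huybrechts2016K3, Ch. 3 §2.3 (PDF p. 59)] -/
theorem finrank_integralHodgeAnnihilator_le_prod (e₂ : Fin n₂ ≃ ι₂) (e : Fin n ≃ ι₁ ⊕ ι₂) (h₂ : k + l = n₂) (H : N₁ + k + l = n)
    {g₁ : ℕ} (hg₁ : finrank ℂ E₁ = g₁) (p : ℕ) :
    finrank ℤ ↥(integralForms Φ₂ l ⊓ ⨅ s : integralHodgeClassesIn Φ₂ k p,
        (LinearMap.ker (poincarePairing Φ₂ e₂ h₂ (s : E₂ [⋀^Fin k]→L[ℝ] ℂ))).toAddSubgroup) ≤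
      finrank ℤ ↥(integralForms (prodPeriod Φ₁ Φ₂) l ⊓ ⨅ S : integralHodgeClassesIn (prodPeriod Φ₁ Φ₂) (N₁ + k) (g₁ + p),
        (LinearMap.ker (poincarePairing (prodPeriod Φ₁ Φ₂) e H (S : (E₁ × E₂) [⋀^Fin (N₁ + k)]→L[ℝ] ℂ))).toAddSubgroup) := by
  obtain ⟨P, -, hP⟩ := exists_intLinearMap_integralHodgeAnnihilator_comp_snd Φ₁ Φ₂ e₁ e₂ e h₂ H hg₁ p
  haveI := moduleFinite_integralHodgeAnnihilator (prodPeriod Φ₁ Φ₂) e H (g₁ + p) (k := N₁ + k) (l := l)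
  exact LinearMap.finrank_le_finrank_of_injective hP

include e₁ in
/-- **`T(X₁ × X₂) ∋ x = p₂^* ι₂^* x + (x − p₂^* ι₂^* x)` with `x − p₂^* ι₂^* x ∈ T(X₁ × X₂) ∩ ker ι₂^*`**: the transcendental lattice of the
product splits as `p₂^* T(X₂) ⊕ (T(X₁ × X₂) ∩ ker ι₂^*)` (both summands inside `T`, by §3 and §6).
[cite: HatcherAT2002, §3.2 Thm. 3.15] [cite: VoisinHodgeI2002, §7.3.2 (PDF pp. 150–151)] -/
theorem sub_comp_snd_comp_inr_mem_integralHodgeAnnihilator (e₂ : Fin n₂ ≃ ι₂) (e : Fin n ≃ ι₁ ⊕ ι₂) (h₂ : k + l = n₂)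
    (H : N₁ + k + l = n) {g₁ : ℕ} (hg₁ : finrank ℂ E₁ = g₁) (p : ℕ) {x : (E₁ × E₂) [⋀^Fin l]→L[ℝ] ℂ}
    (hx : x ∈ integralForms (prodPeriod Φ₁ Φ₂) l ⊓ ⨅ S : integralHodgeClassesIn (prodPeriod Φ₁ Φ₂) (N₁ + k) (g₁ + p),
        (LinearMap.ker (poincarePairing (prodPeriod Φ₁ Φ₂) e H (S : (E₁ × E₂) [⋀^Fin (N₁ + k)]→L[ℝ] ℂ))).toAddSubgroup) :
    x - (x.compContinuousLinearMap (ContinuousLinearMap.inr ℝ E₁ E₂)).compContinuousLinearMap (ContinuousLinearMap.snd ℝ E₁ E₂) ∈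
        integralForms (prodPeriod Φ₁ Φ₂) l ⊓ ⨅ S : integralHodgeClassesIn (prodPeriod Φ₁ Φ₂) (N₁ + k) (g₁ + p),
          (LinearMap.ker (poincarePairing (prodPeriod Φ₁ Φ₂) e H (S : (E₁ × E₂) [⋀^Fin (N₁ + k)]→L[ℝ] ℂ))).toAddSubgroup ∧
      (x - (x.compContinuousLinearMap (ContinuousLinearMap.inr ℝ E₁ E₂)).compContinuousLinearMap
          (ContinuousLinearMap.snd ℝ E₁ E₂)).compContinuousLinearMap (ContinuousLinearMap.inr ℝ E₁ E₂) = 0 := by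
  refine ⟨sub_mem hx (comp_snd_mem_integralHodgeAnnihilator Φ₁ Φ₂ e₁ e₂ e h₂ H hg₁ p
    (compContinuousLinearMap_inr_mem_integralHodgeAnnihilator Φ₁ Φ₂ e₁ e₂ e h₂ H hg₁ p hx)), ?_⟩
  have hsub : ∀ (a b : (E₁ × E₂) [⋀^Fin l]→L[ℝ] ℂ), (a - b).compContinuousLinearMap (ContinuousLinearMap.inr ℝ E₁ E₂) =
      a.compContinuousLinearMap (ContinuousLinearMap.inr ℝ E₁ E₂) - b.compContinuousLinearMap (ContinuousLinearMap.inr ℝ E₁ E₂) :=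
    fun a b ↦ by ext v; rfl
  rw [hsub, compContinuousLinearMap_snd_inr, sub_self]

/-! ## §8 The lattices do not depend on the enumeration of the lattice basis -/

omit [Fintype ι₂] [DecidableEq ι₁] in
/-- **The degree-`l` transcendental lattice does not depend on the enumeration `e` used for `⟨ , ⟩_e`**: `⟨γ, δ⟩_e = sign(ẽ) ∫_X γ ∧ δ` with
`∫_X` independent of the enumeration (`torusIntegral_eq_torusIntegral`), so the kernels `ker ⟨s, ·⟩_e` agree for all `e`.
[cite: Lange2023AbelianVarietiesComplex, §6.2.4 (p. 310)] [cite: Huybrechts2016K3, Ch. 3 §2.2 Def. 2.5 (PDF p. 58)] -/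
theorem integralHodgeAnnihilator_eq_of_enum {ι E : Type*} [Fintype ι] [DecidableEq ι] [NormedAddCommGroup E] [NormedSpace ℂ E]
    (Φ : (ι → ℝ) ≃L[ℝ] E) {m a b : ℕ} (e e' : Fin m ≃ ι) (h : a + b = m) (p : ℕ) :
    (integralForms Φ b ⊓ ⨅ s : integralHodgeClassesIn Φ a p,
        (LinearMap.ker (poincarePairing Φ e h (s : E [⋀^Fin a]→L[ℝ] ℂ))).toAddSubgroup) =
      integralForms Φ b ⊓ ⨅ s : integralHodgeClassesIn Φ a p,
        (LinearMap.ker (poincarePairing Φ e' h (s : E [⋀^Fin a]→L[ℝ] ℂ))).toAddSubgroup := by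
  have key : ∀ (s : E [⋀^Fin a]→L[ℝ] ℂ) (x : E [⋀^Fin b]→L[ℝ] ℂ),
      poincarePairing Φ e h s x = 0 ↔ poincarePairing Φ e' h s x = 0 := by
    intro s x
    rw [poincarePairing_eq_orientationSign_mul_torusIntegral_wedge Φ e h,
      poincarePairing_eq_orientationSign_mul_torusIntegral_wedge Φ e' h,
      torusIntegral_eq_torusIntegral Φ ((finCongr h).trans e) ((finCongr h).trans e'), mul_eq_zero, mul_eq_zero,
      or_iff_right (orientationSign_cast_ne_zero₃₃ Φ _), or_iff_right (orientationSign_cast_ne_zero₃₃ Φ _)]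
  ext x
  simp only [AddSubgroup.mem_inf, AddSubgroup.mem_iInf, Submodule.mem_toAddSubgroup, LinearMap.mem_ker, key]

end ProductProjection

end Literature.Geometry.Kaehler.ComplexTorus
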